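import Summits.QuantumFields.YangMills.Theorems.IR.VacuumEscapePhysicalTimeOfGapTorus
import Summits.QuantumFields.YangMills.Theorems.IR.VacuumEscapeGapOfPhysicalTime
import HarnessLib

/-!
# Line `vacuum_escape` (crux `BalabanLadder.IR`, stmt-QuantumFields-19354) — physical-time currency, part 4b:
# `SliceGapInUnits ⇒ PhysicalTimeConductance` and the EQUIVALENCE (census row B6)

The gap face `SliceGapInUnits` (rate `c₁`) gives physical-time conductance with `τ = 1`, `k₀ = (1 − e^{−c₁})/2` (part 4a with `n = ⌈1/aβ⌉`, so that
`n·aβ ≥ 1` and `1 − e^{−c₁ aβ n} ≥ 1 − e^{−c₁} > k₀`): `physicalTimeConductance_of_sliceGapInUnits`.  With part 3c: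
**`physicalTimeConductance_iff_sliceGapInUnits`** — census row B6 of line `vacuum_escape` («PHYSICAL-TIME CONDUCTANCE ⇔ GAP FACE up to constants»,
EQUIV, priced) is a THEOREM for every compact `G`, every lattice representation and every unit map `a > 0` with `a → 0`.

HONEST FRAMING: a format equivalence between two typed currencies of ONE line of an open crux of a CONDITIONAL chain; the content of the line
(the LOAD `stub_noStickySliceEvent`, weak-coupling volume-uniform isoperimetry) is untouched; nothing here proves `BalabanLadder.IR`, a lattice
gap, or the Yang–Mills mass gap (Clay); R4 of the ladder closes only `BalabanLadder.UV`.
-/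

set_option autoImplicit false

noncomputable section

open MeasureTheory Filter Set Function
open scoped Topology
open Literature.MathematicalPhysics.QuantumFieldTheory

namespace Summit.QuantumFields.YangMills.Cruxes.IR.VacuumEscape


/-- **`SliceGapInUnits ⇒ PhysicalTimeConductance`** (the variational direction of census row B6): the gap face at rate `c₁` gives
physical-time conductance with `τ = 1` and `k₀ = (1 − e^{−c₁})/2` (`β ≥ max(β₂, 0)`, `S₁` unchanged). -/
theorem physicalTimeConductance_of_sliceGapInUnits
    {G : Type} [Group G] [TopologicalSpace G] [IsTopologicalGroup G] [CompactSpace G] [MeasurableSpace G] [BorelSpace G]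
    (r : LatticeRep G) (a : ℝ → ℝ) (ha : ∀ β, 0 < a β) :
    SliceGapInUnits G r a → PhysicalTimeConductance G r a := by
  rintro ⟨c₁, β₂, S₁, hc₁, hgap⟩
  haveI : SecondCountableTopology G :=
    (r.continuous.isClosedEmbedding r.injective).isEmbedding.secondCountableTopology
  have hk₀ : 0 < (1 - Real.exp (-c₁)) / 2 := by
    have : Real.exp (-c₁) < 1 := Real.exp_lt_one_iff.2 (by linarith)
    linarith
  refine ⟨(1 - Real.exp (-c₁)) / 2, 1, max β₂ 0, S₁, hk₀, one_pos, fun β hβ S hS A hA => ?_⟩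
  have hβ₂ : β₂ ≤ β := le_trans (le_max_left _ _) hβ
  have hβ0 : 0 ≤ β := le_trans (le_max_right _ _) hβ
  have haβ := ha β
  set nlag : ℕ := ⌈1 / a β⌉₊ with hnlag
  have hn1 : 1 ≤ nlag := Nat.one_le_iff_ne_zero.2 (Nat.pos_iff_ne_zero.1 (Nat.ceil_pos.2 (div_pos one_pos haβ)))
  obtain ⟨rlag, hrlag⟩ : ∃ rlag : ℕ, nlag = rlag + 1 := ⟨nlag - 1, by omega⟩
  obtain ⟨Kx, hKx⟩ := hgap β hβ₂ S hS
  have hx : ∀ m : ℕ, traceExcess r.ρ β (2 * S + 1) (m + 2) ≤ Kx * Real.exp (-(c₁ * a β * ((m + 2 : ℕ) : ℝ))) :=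
    fun m => hKx (m + 2) (by omega)
  -- `k₀ < 1 − e^{−c₁ aβ (rlag+1)}` since `aβ · n ≥ 1`
  have hklt : (1 - Real.exp (-c₁)) / 2 < 1 - Real.exp (-(c₁ * a β * ((rlag : ℝ) + 1))) := by
    have hge : 1 ≤ a β * ((rlag : ℝ) + 1) := by
      have h1 : 1 / a β ≤ (nlag : ℝ) := Nat.le_ceil _
      have h2 : ((rlag : ℝ) + 1) = (nlag : ℝ) := by rw [hrlag]; push_cast; ring
      rw [h2]
      have := mul_le_mul_of_nonneg_left h1 haβ.le
      rw [mul_one_div_cancel haβ.ne'] at this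
      exact this
    have hexp : Real.exp (-(c₁ * a β * ((rlag : ℝ) + 1))) ≤ Real.exp (-c₁) := by
      refine Real.exp_le_exp.2 (neg_le_neg ?_)
      have := mul_le_mul_of_nonneg_left hge hc₁.le
      rw [mul_one] at this
      linarith [this, mul_assoc c₁ (a β) ((rlag : ℝ) + 1)]
    have hlt1 : Real.exp (-c₁) < 1 := Real.exp_lt_one_iff.2 (by linarith)
    linarith
  obtain ⟨m₀, hm₀⟩ := lagConductance_eventually_of_traceExcess_le r.continuous r.mem_unitary hβ0 S rlag hx hklt A hA
  refine ⟨m₀, fun m hm => ?_⟩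
  have := hm₀ m hm
  rw [← hrlag, hnlag] at this
  exact this

/-- **Census row B6 of line `vacuum_escape` is a theorem: `PhysicalTimeConductance ↔ SliceGapInUnits`** for every compact `G`, every lattice
representation `r` and every unit map `a > 0` with `a → 0` (parts 3 and 4).  The line's content (the LOAD, weak-coupling volume-uniform
one-step isoperimetry `stub_noStickySliceEvent`) and the crux `BalabanLadder.IR` are untouched. -/
theorem physicalTimeConductance_iff_sliceGapInUnits
    {G : Type} [Group G] [TopologicalSpace G] [IsTopologicalGroup G] [CompactSpace G] [MeasurableSpace G] [BorelSpace G]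
    (r : LatticeRep G) (a : ℝ → ℝ) (ha : ∀ β, 0 < a β) (ha0 : Tendsto a atTop (𝓝 0)) :
    PhysicalTimeConductance G r a ↔ SliceGapInUnits G r a :=
  ⟨sliceGapInUnits_of_physicalTimeConductance r a ha ha0, physicalTimeConductance_of_sliceGapInUnits r a ha⟩


end Summit.QuantumFields.YangMills.Cruxes.IR.VacuumEscape

end
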